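import Literature.AlgebraicGeometry.Resolution.FibreCoheightInequality
import Literature.AlgebraicGeometry.Resolution.PermissibleBlowupFibreDimension
import HarnessLib

/-!
# Matsumura's fibre inequality in codimension form, SHARP fibre term:
# `codim_{cl ζ'}(x') ≤ codim_{cl π ζ'}(π x') + codim_{cl ζ' ∩ π⁻¹(π x')}(x')`, and the depth-jump law it implies

Topic: `Literature/AlgebraicGeometry/Resolution`. H. Matsumura, *Commutative Ring Theory*, Thm. 15.1 (i):
"`ht P ≤ ht 𝔭 + dim B_P/𝔭B_P`" (Mathlib `Ideal.height_le_height_add_of_liesOver`). The companion file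
`FibreCoheightInequality.lean` bounds the fibre term by the dimension of the whole fibre `𝒪_{X',x'}/𝔪_{π x'}𝒪_{X',x'}`;
here the fibre term is the honest one — the codimension of `x'` inside `cl ζ' ∩ π⁻¹(π x')` (the fibre OF THE CLOSED
SUBSET `cl ζ'`), i.e. the dimension of `(𝒪_{X',x'}/𝔭_{ζ'})/𝔪_{π x'}` — for a morphism `π : X' → X` of locally Noetherian
schemes and a generisation `ζ' ⤳ x'`:

* `coheight_closure_le_add_coheight_fibre` — **`codim_{cl ζ'}(x') ≤ codim_{cl π ζ'}(π x') + codim_{cl ζ' ∩ π⁻¹(π x')}(x')`**;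
* `exists_mem_fibre_specializes_of_coheight_lt` — **THE DEPTH-JUMP LAW**: if `codim_{cl π ζ'}(π x') < codim_{cl ζ'}(x')`
  (e.g. a «sandwich» at `x'` in `cl ζ'` and none at `π x'` in `cl π ζ'`), then `cl ζ'` contains a generisation `z' ≠ x'`
  of `x'` INSIDE THE FIBRE `π⁻¹(π x')` — for any morphism, any characteristic, no centre in sight;
* `coheight_preimage_le_ringKrullDim_quotient_map_maximalIdeal` — `codim_{π⁻¹(π x')}(x') ≤ dim 𝒪_{X',x'}/𝔪_{π x'}𝒪_{X',x'}`;
* `IsBlowup.coheight_closure_le_add_of_isPermissibleAt` — for a blow-up in a centre `D` permissible at `x = π x'` with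
  `dim 𝒪_{X,x}/D_x = s` and `dim 𝒪_{X,x} ≤ s + 1 + e`: **`codim_{cl ζ'}(x') ≤ codim_{cl π ζ'}(π x') + e`** (the fibres have
  dimension `≤ e`, `PermissibleBlowupFibreDimension.lean`): NO depth jump over a surface centre in a threefold (`e = 0`), a jump
  by at most one over a curve centre (`e = 1`); `IsBlowup.coheight_preimage_le_of_isPermissibleAt` — `codim_{π⁻¹(x)}(x') ≤ e`;
* `subset_closure_of_mem_of_coheight_le_one` — if the fibre `F ∋ x'` is irreducible and closed with `codim_F(x') ≤ 1`, a
  generisation `z' ≠ x'` of `x'` in `F ∩ cl ζ'` forces **`F ⊆ cl ζ'`** (the whole `ℙ¹` over `x` lies in `cl ζ'`).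

Consumer: the Hironaka campaign's W4.2 ROW-J («no late depth jumps») support file `…Corridor3WLadderStrataDepthRuled`.
No definitions, no named facts; nothing here is specific to resolution of singularities.

## Sources

* H. Matsumura, *Commutative Ring Theory* (1986), Thm. 15.1 (i). [Matsumura1987]
* The Stacks Project, Tags 00OM, 01J7. [StacksProject]
* V. Cossart, U. Jannsen, S. Saito, LNM 2270 (2020), proof of Thm. 3.10 (p. 46) (fibres of permissible blow-ups).
  [CossartJannsenSaito2020]
-/

noncomputable section

open CategoryTheory AlgebraicGeometry TopologicalSpace Topology IsLocalRing Order

namespace Literature.AlgebraicGeometry.Resolution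

universe u

variable {X X' : Scheme.{u}}

/-- For a local ring `A` and an ideal `J ≠ ⊤`, `(𝔪_{A/J}).comap mk = 𝔪_A`. [folklore] -/
private theorem comap_mk_maximalIdeal' {A : Type u} [CommRing A] [IsLocalRing A] (J : Ideal A) (hJ : J ≠ ⊤) :
    haveI : Nontrivial (A ⧸ J) := Ideal.Quotient.nontrivial_iff.mpr hJ
    haveI : IsLocalRing (A ⧸ J) := IsLocalRing.of_surjective' (Ideal.Quotient.mk J) Ideal.Quotient.mk_surjective
    (maximalIdeal (A ⧸ J)).comap (Ideal.Quotient.mk J) = maximalIdeal A := by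
  haveI : Nontrivial (A ⧸ J) := Ideal.Quotient.nontrivial_iff.mpr hJ
  haveI : IsLocalRing (A ⧸ J) := IsLocalRing.of_surjective' (Ideal.Quotient.mk J) Ideal.Quotient.mk_surjective
  haveI := IsLocalHom.of_surjective (Ideal.Quotient.mk J) Ideal.Quotient.mk_surjective
  exact maximalIdeal_comap _

/-- The prime of a generisation over the SAME point of the base contains `𝔪_{π x'}𝒪_{X',x'}`, and conversely: for
`z' ⤳ x'`, `𝔪_{π x'}𝒪_{X',x'} ≤ 𝔭_{z'} ↔ π z' = π x'` ((π^♯)⁻¹𝔭_{z'} = 𝔭_{π z'}`, which is `𝔪_{π x'}` iff `π z' = π x'`).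
[cite: StacksProject, Tag 01J7] -/
theorem map_maximalIdeal_le_primeOfSpecializes_iff (π : X' ⟶ X) {z' x' : X'} (hz : z' ⤳ x') :
    (maximalIdeal (X.presheaf.stalk (π.base x'))).map (π.stalkMap x').hom ≤ primeOfSpecializes hz ↔
      π.base z' = π.base x' := by
  rw [Ideal.map_le_iff_le_comap, comap_stalkMap_primeOfSpecializes π hz]
  constructor
  · intro hle
    have heq : primeOfSpecializes (hz.map π.continuous : π.base z' ⤳ π.base x') =
        maximalIdeal (X.presheaf.stalk (π.base x')) :=
      ((IsLocalRing.maximalIdeal.isMaximal _).eq_of_le (Ideal.IsPrime.ne_top inferInstance) hle).symm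
    have h1 : X.fromSpecStalk (π.base x') ⟨primeOfSpecializes (hz.map π.continuous : π.base z' ⤳ π.base x'), inferInstance⟩ =
        π.base z' :=
      Literature.AlgebraicGeometry.Motives.fromSpecStalk_comap_maximalIdeal _
    have h2 : X.fromSpecStalk (π.base x') ⟨maximalIdeal (X.presheaf.stalk (π.base x')), inferInstance⟩ = π.base x' :=
      Scheme.fromSpecStalk_closedPoint
    calc π.base z' = X.fromSpecStalk (π.base x') ⟨primeOfSpecializes (hz.map π.continuous : π.base z' ⤳ π.base x'),
          inferInstance⟩ := h1.symm
      _ = X.fromSpecStalk (π.base x') ⟨maximalIdeal (X.presheaf.stalk (π.base x')), inferInstance⟩ :=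
          congrArg (fun q => (X.fromSpecStalk (π.base x')).base q) (PrimeSpectrum.ext heq)
      _ = π.base x' := h2
  · intro heq
    have gen : ∀ (y : X) (hy : y ⤳ π.base x'), y = π.base x' →
        primeOfSpecializes hy = maximalIdeal (X.presheaf.stalk (π.base x')) := by
      rintro y hy rfl
      change (maximalIdeal _).comap (X.presheaf.stalkSpecializes (specializes_refl _)).hom = _
      rw [TopCat.Presheaf.stalkSpecializes_refl]
      exact Ideal.comap_id _
    exact le_of_eq (gen _ _ heq).symm

/-- **`codim_{π⁻¹(π x')}(x') ≤ dim 𝒪_{X',x'}/𝔪_{π x'}𝒪_{X',x'}`**: generisations of `x'` in its fibre have primes above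
`𝔪_{π x'}𝒪_{X',x'}`. [cite: StacksProject, Tag 01J7] -/
theorem coheight_preimage_le_ringKrullDim_quotient_map_maximalIdeal (π : X' ⟶ X) (x' : X') :
    ((coheight (⟨x', rfl⟩ : ↥(π.base ⁻¹' {π.base x'})) : ℕ∞) : WithBot ℕ∞) ≤
      ringKrullDim (X'.presheaf.stalk x' ⧸ (maximalIdeal (X.presheaf.stalk (π.base x'))).map (π.stalkMap x').hom) := by
  set x₀ : ↥(π.base ⁻¹' {π.base x'}) := ⟨x', rfl⟩ with hx₀
  set J : Ideal (X'.presheaf.stalk x') := (maximalIdeal (X.presheaf.stalk (π.base x'))).map (π.stalkMap x').hom with hJ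
  rw [coheight_eq_krullDim_Ici, ringKrullDim_quotient, ← krullDim_orderDual (α := ↥(Set.Ici x₀))]
  set pt : PrimeSpectrum (X'.presheaf.stalk x') → X' := fun q => (X'.fromSpecStalk x').base q with hpt
  have hpt_iff : ∀ q q' : PrimeSpectrum (X'.presheaf.stalk x'), pt q ⤳ pt q' ↔ q.asIdeal ≤ q'.asIdeal :=
    fun q q' => fromSpecStalk_specializes_iff_le q q'
  let G : (↥(Set.Ici x₀))ᵒᵈ → PrimeSpectrum.zeroLocus (R := X'.presheaf.stalk x') (J : Set (X'.presheaf.stalk x')) :=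
    fun y => ⟨⟨primeOfSpecializes (Scheme.le_iff_specializes.mp (OrderDual.ofDual y).2), inferInstance⟩,
      (map_maximalIdeal_le_primeOfSpecializes_iff π _).mpr (OrderDual.ofDual y).1.2⟩
  have hGpt : ∀ y, pt (G y).1 = ((OrderDual.ofDual y).1 : X') := fun y =>
    Literature.AlgebraicGeometry.Motives.fromSpecStalk_comap_maximalIdeal _
  have hG : StrictMono G := by
    intro y y' hyy'
    have hlt : OrderDual.ofDual y' < OrderDual.ofDual y := hyy'
    have hle : ((OrderDual.ofDual y).1 : X') ⤳ ((OrderDual.ofDual y').1 : X') :=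
      Scheme.le_iff_specializes.mp (le_of_lt hlt)
    have hnle : ¬ ((OrderDual.ofDual y').1 : X') ⤳ ((OrderDual.ofDual y).1 : X') := fun e =>
      (lt_iff_le_not_ge.mp hlt).2 (Scheme.le_iff_specializes.mpr e)
    change (G y).1 < (G y').1
    refine lt_iff_le_not_ge.mpr ⟨?_, ?_⟩
    · rw [← PrimeSpectrum.asIdeal_le_asIdeal, ← hpt_iff, hGpt, hGpt]
      exact hle
    · intro e
      apply hnle
      rw [← hGpt y, ← hGpt y']
      exact (hpt_iff _ _).mpr ((PrimeSpectrum.asIdeal_le_asIdeal _ _).mpr e)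
  exact krullDim_le_of_strictMono G hG

/-- **MATSUMURA'S FIBRE INEQUALITY WITH THE SHARP FIBRE TERM.** For a morphism `π : X' → X` of locally Noetherian schemes
and a generisation `ζ' ⤳ x'`:
`codim_{cl ζ'}(x') ≤ codim_{cl π ζ'}(π x') + codim_{cl ζ' ∩ π⁻¹(π x')}(x')` — Thm. 15.1 (i) for
`𝒪_{X,π x'}/𝔭_{π ζ'} → 𝒪_{X',x'}/𝔭_{ζ'}`, whose fibre ring `T` has its primes among the primes `Q ⊇ 𝔭_{ζ'} + 𝔪_{π x'}𝒪_{X',x'}`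
of `𝒪_{X',x'}`, i.e. among the generisations of `x'` in `cl ζ'` over `π x'`.
[cite: Matsumura1987, Thm. 15.1] [cite: StacksProject, Tag 00OM] -/
theorem coheight_closure_le_add_coheight_fibre [IsLocallyNoetherian X] [IsLocallyNoetherian X'] (π : X' ⟶ X)
    {ζ' x' : X'} (h : ζ' ⤳ x') :
    coheight (⟨x', specializes_iff_mem_closure.mp h⟩ : ↥(closure ({ζ'} : Set X'))) ≤
      coheight (⟨π.base x', specializes_iff_mem_closure.mp (h.map π.continuous)⟩ : ↥(closure ({π.base ζ'} : Set X))) +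
        coheight (⟨x', ⟨specializes_iff_mem_closure.mp h, rfl⟩⟩ :
          ↥(closure ({ζ'} : Set X') ∩ π.base ⁻¹' {π.base x'})) := by
  -- the rings (as in `coheight_closure_le_add_ringKrullDim_fibre`)
  set O := X.presheaf.stalk (π.base x') with hO
  set O' := X'.presheaf.stalk x' with hO'
  set f : O →+* O' := (π.stalkMap x').hom with hf
  set 𝔮' : Ideal O' := primeOfSpecializes h with h𝔮'
  set 𝔮 : Ideal O := primeOfSpecializes (h.map π.continuous : π.base ζ' ⤳ π.base x') with h𝔮def
  have h𝔮 : 𝔮'.comap f = 𝔮 := comap_stalkMap_primeOfSpecializes π h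
  haveI : 𝔮'.IsPrime := by rw [h𝔮']; infer_instance
  haveI : 𝔮.IsPrime := by rw [h𝔮def]; infer_instance
  set g : O ⧸ 𝔮 →+* O' ⧸ 𝔮' := Ideal.quotientMap 𝔮' f (by rw [h𝔮]) with hg
  letI : Algebra (O ⧸ 𝔮) (O' ⧸ 𝔮') := g.toAlgebra
  haveI : Nontrivial (O ⧸ 𝔮) := Ideal.Quotient.nontrivial_iff.mpr (Ideal.IsPrime.ne_top inferInstance)
  haveI : Nontrivial (O' ⧸ 𝔮') := Ideal.Quotient.nontrivial_iff.mpr (Ideal.IsPrime.ne_top inferInstance)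
  haveI : IsLocalRing (O ⧸ 𝔮) := IsLocalRing.of_surjective' (Ideal.Quotient.mk 𝔮) Ideal.Quotient.mk_surjective
  haveI : IsLocalRing (O' ⧸ 𝔮') := IsLocalRing.of_surjective' (Ideal.Quotient.mk 𝔮') Ideal.Quotient.mk_surjective
  have hcomap : (maximalIdeal (O' ⧸ 𝔮')).comap g = maximalIdeal (O ⧸ 𝔮) := by
    apply Ideal.comap_injective_of_surjective (Ideal.Quotient.mk 𝔮) Ideal.Quotient.mk_surjective
    rw [Ideal.comap_comap, comap_mk_maximalIdeal' 𝔮 (Ideal.IsPrime.ne_top inferInstance)]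
    have hgc : g.comp (Ideal.Quotient.mk 𝔮) = (Ideal.Quotient.mk 𝔮').comp f := by
      ext r; rfl
    rw [hgc, ← Ideal.comap_comap, comap_mk_maximalIdeal' 𝔮' (Ideal.IsPrime.ne_top inferInstance), hf]
    exact maximalIdeal_comap _
  haveI : (maximalIdeal (O' ⧸ 𝔮')).LiesOver (maximalIdeal (O ⧸ 𝔮)) := ⟨by rw [Ideal.under_def]; exact hcomap.symm⟩
  -- Matsumura 15.1 (i)
  have key := Ideal.height_le_height_add_of_liesOver (maximalIdeal (O ⧸ 𝔮)) (maximalIdeal (O' ⧸ 𝔮'))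
  -- the fibre ring `T` and the surjection `σ : 𝒪' → T`
  set T := (O' ⧸ 𝔮') ⧸ (maximalIdeal (O ⧸ 𝔮)).map (algebraMap (O ⧸ 𝔮) (O' ⧸ 𝔮')) with hT
  haveI : Nontrivial T := Ideal.Quotient.nontrivial_iff.mpr (by
      refine ne_top_of_le_ne_top (Ideal.IsPrime.ne_top (inferInstance : (maximalIdeal (O' ⧸ 𝔮')).IsPrime)) ?_
      rw [Ideal.map_le_iff_le_comap]
      exact le_of_eq hcomap.symm)
  haveI : IsLocalRing T := IsLocalRing.of_surjective' (Ideal.Quotient.mk _) Ideal.Quotient.mk_surjective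
  set σ : O' →+* T := (Ideal.Quotient.mk ((maximalIdeal (O ⧸ 𝔮)).map (algebraMap (O ⧸ 𝔮) (O' ⧸ 𝔮')))).comp
    (Ideal.Quotient.mk 𝔮') with hσ
  have hσsurj : Function.Surjective σ := Ideal.Quotient.mk_surjective.comp Ideal.Quotient.mk_surjective
  have h𝔮'ker : 𝔮' ≤ RingHom.ker σ := by
    intro r hr
    rw [RingHom.mem_ker, hσ, RingHom.comp_apply, (Ideal.Quotient.eq_zero_iff_mem).mpr hr, map_zero]
  have hJker : (maximalIdeal O).map f ≤ RingHom.ker σ := by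
    rw [Ideal.map_le_iff_le_comap]
    intro r hr
    rw [Ideal.mem_comap, RingHom.mem_ker, hσ, RingHom.comp_apply, Ideal.Quotient.eq_zero_iff_mem]
    have h1 : Ideal.Quotient.mk 𝔮' (f r) = algebraMap (O ⧸ 𝔮) (O' ⧸ 𝔮') (Ideal.Quotient.mk 𝔮 r) := rfl
    rw [h1]
    refine Ideal.mem_map_of_mem (algebraMap (O ⧸ 𝔮) (O' ⧸ 𝔮')) ?_
    have h2 : Ideal.Quotient.mk 𝔮 r ∈ (maximalIdeal O).map (Ideal.Quotient.mk 𝔮) := Ideal.mem_map_of_mem _ hr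
    rwa [map_maximalIdeal_of_surjective (Ideal.Quotient.mk 𝔮) Ideal.Quotient.mk_surjective] at h2
  -- `dim T ≤ codim_{cl ζ' ∩ π⁻¹(π x')}(x')`: primes of `T` pull back to primes `Q ⊇ 𝔮', 𝔪_x𝒪'`, i.e. to generisations of
  -- `x'` in `cl ζ'` over `π x'`, order reversed
  set W : Set X' := closure ({ζ'} : Set X') ∩ π.base ⁻¹' {π.base x'} with hW
  set x₀ : ↥W := ⟨x', ⟨specializes_iff_mem_closure.mp h, rfl⟩⟩ with hx₀
  have hTW : ringKrullDim T ≤ ((coheight x₀ : ℕ∞) : WithBot ℕ∞) := by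
    rw [coheight_eq_krullDim_Ici, ringKrullDim, ← krullDim_orderDual (α := ↥(Set.Ici x₀))]
    set pt : PrimeSpectrum O' → X' := fun q => (X'.fromSpecStalk x').base q with hpt
    have hpt_sp : ∀ q, pt q ⤳ x' := fun q => fromSpecStalk_specializes q
    have hpt_iff : ∀ q q' : PrimeSpectrum O', pt q ⤳ pt q' ↔ q.asIdeal ≤ q'.asIdeal :=
      fun q q' => fromSpecStalk_specializes_iff_le q q'
    have hζpt : pt ⟨𝔮', inferInstance⟩ = ζ' := Literature.AlgebraicGeometry.Motives.fromSpecStalk_comap_maximalIdeal h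
    have hζ_iff : ∀ q : PrimeSpectrum O', ζ' ⤳ pt q ↔ 𝔮' ≤ q.asIdeal := by
      intro q
      have e := hpt_iff ⟨𝔮', inferInstance⟩ q
      rw [hζpt] at e
      exact e
    -- the point of a prime of `T`
    have hptW : ∀ P : PrimeSpectrum T, pt ⟨P.asIdeal.comap σ, Ideal.comap_isPrime σ _⟩ ∈ W := by
      intro P
      refine ⟨specializes_iff_mem_closure.mp ((hζ_iff _).mpr (h𝔮'ker.trans (Ideal.comap_mono bot_le))), ?_⟩
      -- over `π x'`: `𝔪_x 𝒪' ≤ Q`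
      have hQ : (maximalIdeal O).map f ≤ P.asIdeal.comap σ := hJker.trans (Ideal.comap_mono bot_le)
      have hprime : primeOfSpecializes (hpt_sp ⟨P.asIdeal.comap σ, Ideal.comap_isPrime σ _⟩) = P.asIdeal.comap σ :=
        primeOfSpecializes_fromSpecStalk _
      have := (map_maximalIdeal_le_primeOfSpecializes_iff π (hpt_sp ⟨P.asIdeal.comap σ, Ideal.comap_isPrime σ _⟩)).mp
        (by rw [hprime]; exact hQ)
      exact this
    let F : PrimeSpectrum T → (↥(Set.Ici x₀))ᵒᵈ := fun P =>
      OrderDual.toDual ⟨⟨pt ⟨P.asIdeal.comap σ, Ideal.comap_isPrime σ _⟩, hptW P⟩,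
        Scheme.le_iff_specializes.mpr (hpt_sp _)⟩
    have hF : StrictMono F := by
      intro P P' hPP'
      change OrderDual.ofDual (F P') < OrderDual.ofDual (F P)
      have hle : P.asIdeal.comap σ ≤ P'.asIdeal.comap σ := Ideal.comap_mono (le_of_lt hPP')
      have hnle : ¬ P'.asIdeal.comap σ ≤ P.asIdeal.comap σ := fun h' =>
        (ne_of_lt hPP') (PrimeSpectrum.ext (le_antisymm (le_of_lt hPP')
          ((Ideal.comap_le_comap_iff_of_surjective σ hσsurj _ _).mp h')))
      refine lt_iff_le_not_ge.mpr ⟨?_, ?_⟩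
      · exact Scheme.le_iff_specializes.mpr ((hpt_iff _ _).mpr hle)
      · intro e
        exact hnle ((hpt_iff _ _).mp (Scheme.le_iff_specializes.mp e))
    exact krullDim_le_of_strictMono F hF
  -- heights ↔ codimensions
  have hS : ((coheight (⟨x', specializes_iff_mem_closure.mp h⟩ : ↥(closure ({ζ'} : Set X'))) : ℕ∞) : WithBot ℕ∞) =
      (maximalIdeal (O' ⧸ 𝔮')).height := by
    rw [coheight_closure_eq_ringKrullDim_quotient h, IsLocalRing.maximalIdeal_height_eq_ringKrullDim]
  have hR : ((coheight (⟨π.base x', specializes_iff_mem_closure.mp (h.map π.continuous)⟩ :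
      ↥(closure ({π.base ζ'} : Set X))) : ℕ∞) : WithBot ℕ∞) = (maximalIdeal (O ⧸ 𝔮)).height := by
    rw [coheight_closure_eq_ringKrullDim_quotient (h.map π.continuous), IsLocalRing.maximalIdeal_height_eq_ringKrullDim]
  have hTh : (((maximalIdeal (O' ⧸ 𝔮')).map (Ideal.Quotient.mk ((maximalIdeal (O ⧸ 𝔮)).map
      (algebraMap (O ⧸ 𝔮) (O' ⧸ 𝔮'))))).height : WithBot ℕ∞) = ringKrullDim T := by
    have hmax : (maximalIdeal (O' ⧸ 𝔮')).map (Ideal.Quotient.mk ((maximalIdeal (O ⧸ 𝔮)).map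
        (algebraMap (O ⧸ 𝔮) (O' ⧸ 𝔮')))) = maximalIdeal T :=
      map_maximalIdeal_of_surjective _ Ideal.Quotient.mk_surjective
    rw [hmax, IsLocalRing.maximalIdeal_height_eq_ringKrullDim]
  have main : ((coheight (⟨x', specializes_iff_mem_closure.mp h⟩ : ↥(closure ({ζ'} : Set X'))) : ℕ∞) : WithBot ℕ∞) ≤
      ((coheight (⟨π.base x', specializes_iff_mem_closure.mp (h.map π.continuous)⟩ :
        ↥(closure ({π.base ζ'} : Set X))) : ℕ∞) : WithBot ℕ∞) + ((coheight x₀ : ℕ∞) : WithBot ℕ∞) := by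
    rw [hS, hR]
    calc ((maximalIdeal (O' ⧸ 𝔮')).height : WithBot ℕ∞)
        ≤ (((maximalIdeal (O ⧸ 𝔮)).height + ((maximalIdeal (O' ⧸ 𝔮')).map (Ideal.Quotient.mk
            ((maximalIdeal (O ⧸ 𝔮)).map (algebraMap (O ⧸ 𝔮) (O' ⧸ 𝔮'))))).height : ℕ∞) : WithBot ℕ∞) := by
          exact_mod_cast key
      _ = ((maximalIdeal (O ⧸ 𝔮)).height : WithBot ℕ∞) + ringKrullDim T := by rw [← hTh]; push_cast; rfl
      _ ≤ ((maximalIdeal (O ⧸ 𝔮)).height : WithBot ℕ∞) + ((coheight x₀ : ℕ∞) : WithBot ℕ∞) := add_le_add le_rfl hTW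
  have main' : (((coheight (⟨x', specializes_iff_mem_closure.mp h⟩ : ↥(closure ({ζ'} : Set X'))) : ℕ∞)) : WithBot ℕ∞) ≤
      (((coheight (⟨π.base x', specializes_iff_mem_closure.mp (h.map π.continuous)⟩ :
        ↥(closure ({π.base ζ'} : Set X))) + coheight x₀ : ℕ∞)) : WithBot ℕ∞) := by
    push_cast; exact main
  exact WithBot.coe_le_coe.mp main'

/-- **THE DEPTH-JUMP LAW.** For a morphism `π : X' → X` of locally Noetherian schemes and `ζ' ⤳ x'`: if
`codim_{cl π ζ'}(π x') < codim_{cl ζ'}(x')` then there is `z' ∈ cl ζ'` with `z' ⤳ x'`, `z' ≠ x'` and `π z' = π x'` — the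
jump in depth is carried by a positive-dimensional piece of the fibre inside `cl ζ'`. [cite: Matsumura1987, Thm. 15.1] -/
theorem exists_mem_fibre_specializes_of_coheight_lt [IsLocallyNoetherian X] [IsLocallyNoetherian X'] (π : X' ⟶ X)
    {ζ' x' : X'} (h : ζ' ⤳ x')
    (hlt : coheight (⟨π.base x', specializes_iff_mem_closure.mp (h.map π.continuous)⟩ : ↥(closure ({π.base ζ'} : Set X))) <
      coheight (⟨x', specializes_iff_mem_closure.mp h⟩ : ↥(closure ({ζ'} : Set X')))) :
    ∃ z' : X', ζ' ⤳ z' ∧ z' ⤳ x' ∧ z' ≠ x' ∧ π.base z' = π.base x' := by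
  have key := coheight_closure_le_add_coheight_fibre π h
  set x₀ : ↥(closure ({ζ'} : Set X') ∩ π.base ⁻¹' {π.base x'}) := ⟨x', ⟨specializes_iff_mem_closure.mp h, rfl⟩⟩ with hx₀
  have hpos : 0 < coheight x₀ := by
    by_contra h0
    have h0' : coheight x₀ = 0 := nonpos_iff_eq_zero.mp (not_lt.mp h0)
    rw [h0', add_zero] at key
    exact (not_le.mpr hlt) key
  obtain ⟨w, hw⟩ := not_isMax_iff.mp (coheight_pos.mp hpos)
  refine ⟨w.1, specializes_iff_mem_closure.mpr w.2.1, Scheme.le_iff_specializes.mp (le_of_lt hw), ?_, w.2.2⟩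
  intro heq
  have : w = x₀ := Subtype.ext heq
  rw [this] at hw
  exact lt_irrefl _ hw

/-- **If the fibre `F ∋ x'` is irreducible and closed with `codim_F(x') ≤ 1`, a generisation `z' ≠ x'` of `x'` in
`F ∩ cl ζ'` forces `F ⊆ cl ζ'`** (`z'` is the generic point of `F`). [cite: StacksProject, Tag 0061] -/
theorem subset_closure_of_mem_of_coheight_le_one {F : Set X'} (hirr : IsIrreducible F) (hcl : IsClosed F) {x' z' ζ' : X'}
    (hx' : x' ∈ F) (h1 : coheight (⟨x', hx'⟩ : ↥F) ≤ 1) (hz'F : z' ∈ F) (hz' : z' ⤳ x') (hne : z' ≠ x') (hζz : ζ' ⤳ z') :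
    F ⊆ closure ({ζ'} : Set X') := by
  have hgen : IsGenericPoint hirr.genericPoint F := hirr.isGenericPoint_genericPoint hcl
  set η := hirr.genericPoint with hη
  -- `x' < z' ≤ η` in `F`, and `codim_F(x') ≤ 1` forces `z' = η`
  have hxz : (⟨x', hx'⟩ : ↥F) < ⟨z', hz'F⟩ := by
    refine lt_iff_le_not_ge.mpr ⟨Scheme.le_iff_specializes.mpr hz', fun hle => hne ?_⟩
    exact ((Scheme.le_iff_specializes.mp hle).antisymm hz').eq.symm
  have hzη : z' = η := by
    by_contra hne'
    have hlt : (⟨z', hz'F⟩ : ↥F) < ⟨η, hgen.mem⟩ := by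
      refine lt_iff_le_not_ge.mpr ⟨Scheme.le_iff_specializes.mpr (hgen.specializes hz'F), fun hle => hne' ?_⟩
      exact ((hgen.specializes hz'F).antisymm (Scheme.le_iff_specializes.mp hle)).eq.symm
    have h2 : (2 : ℕ∞) ≤ coheight (⟨x', hx'⟩ : ↥F) := by
      have h' := length_le_coheight_head (p := ((RelSeries.singleton _ (⟨x', hx'⟩ : ↥F)).snoc ⟨z', hz'F⟩ hxz).snoc
        ⟨η, hgen.mem⟩ (by rw [RelSeries.last_snoc]; exact hlt))
      simp only [RelSeries.snoc_length, RelSeries.singleton_length, zero_add, RelSeries.head_snoc,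
        RelSeries.head_singleton] at h'
      exact_mod_cast h'
    exact absurd (h2.trans h1) (by decide)
  subst hzη
  rw [← hgen.def]
  exact closure_minimal (Set.singleton_subset_iff.mpr (specializes_iff_mem_closure.mp hζz)) isClosed_closure

/-! ## For a permissible blow-up: the fibres have dimension `≤ dim 𝒪_{X,x} − dim 𝒪_{D,x} − 1` -/

section Blowup

variable {π : X' ⟶ X} {D : X.IdealSheafData}

/-- **`codim_{π⁻¹(x)}(x') ≤ e`** for a blow-up in `D` permissible at `x = π x'` with `dim 𝒪_{X,x}/D_x = s` and
`dim 𝒪_{X,x} ≤ s + 1 + e`. [cite: CossartJannsenSaito2020, Thm. 3.10 (proof, p. 46)] -/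
theorem IsBlowup.coheight_preimage_le_of_isPermissibleAt [IsLocallyNoetherian X] (hπ : IsBlowup π D) (x' : X')
    (hperm : IdealSheafData.IsPermissibleAt D (π.base x')) {s : ℕ}
    (hs : ringKrullDim (X.presheaf.stalk (π.base x') ⧸ stalkIdeal D (π.base x')) = s) {e : ℕ}
    (hdim : ringKrullDim (X.presheaf.stalk (π.base x')) ≤ ((s + 1 + e : ℕ) : WithBot ℕ∞)) :
    coheight (⟨x', rfl⟩ : ↥(π.base ⁻¹' {π.base x'})) ≤ e := by
  have key := hπ.ringKrullDim_stalk_quotient_map_maximalIdeal_add_le x' hperm hs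
  have h1 := coheight_preimage_le_ringKrullDim_quotient_map_maximalIdeal π x'
  -- `codim + (s+1) ≤ dim 𝒪 ≤ (s+1) + e`
  have h2 : ((coheight (⟨x', rfl⟩ : ↥(π.base ⁻¹' {π.base x'})) : ℕ∞) : WithBot ℕ∞) + ((s + 1 : ℕ) : WithBot ℕ∞) ≤
      (e : WithBot ℕ∞) + ((s + 1 : ℕ) : WithBot ℕ∞) := by
    calc _ ≤ ringKrullDim (X'.presheaf.stalk x' ⧸ (maximalIdeal (X.presheaf.stalk (π.base x'))).map (π.stalkMap x').hom) +
          ((s + 1 : ℕ) : WithBot ℕ∞) := add_le_add h1 le_rfl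
      _ ≤ ringKrullDim (X.presheaf.stalk (π.base x')) := key
      _ ≤ ((s + 1 + e : ℕ) : WithBot ℕ∞) := hdim
      _ = (e : WithBot ℕ∞) + ((s + 1 : ℕ) : WithBot ℕ∞) := by push_cast; ring
  have h3 : (coheight (⟨x', rfl⟩ : ↥(π.base ⁻¹' {π.base x'})) : ℕ∞) + ((s + 1 : ℕ) : ℕ∞) ≤ (e : ℕ∞) + ((s + 1 : ℕ) : ℕ∞) := by
    exact_mod_cast h2
  exact_mod_cast (ENat.add_le_add_iff_right (ENat.coe_ne_top _)).mp h3

/-- **`codim_{cl ζ'}(x') ≤ codim_{cl π ζ'}(π x') + e` for a blow-up in a centre permissible at `x = π x'` with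
`dim 𝒪_{X,x} ≤ dim 𝒪_{D,x} + 1 + e`** — NO depth jump over a surface centre in a threefold (`e = 0`), at most a jump by one
over a curve centre (`e = 1`). (Non-sharp form `coheight_closure_le_add_ringKrullDim_fibre` + the fibre dimension bound.)
[cite: Matsumura1987, Thm. 15.1] [cite: CossartJannsenSaito2020, Thm. 3.10 (proof, p. 46)] -/
theorem IsBlowup.coheight_closure_le_add_of_isPermissibleAt [IsLocallyNoetherian X] [IsLocallyNoetherian X']
    (hπ : IsBlowup π D) {ζ' x' : X'} (h : ζ' ⤳ x') (hperm : IdealSheafData.IsPermissibleAt D (π.base x')) {s : ℕ}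
    (hs : ringKrullDim (X.presheaf.stalk (π.base x') ⧸ stalkIdeal D (π.base x')) = s) {e : ℕ}
    (hdim : ringKrullDim (X.presheaf.stalk (π.base x')) ≤ ((s + 1 + e : ℕ) : WithBot ℕ∞)) :
    coheight (⟨x', specializes_iff_mem_closure.mp h⟩ : ↥(closure ({ζ'} : Set X'))) ≤
      coheight (⟨π.base x', specializes_iff_mem_closure.mp (h.map π.continuous)⟩ : ↥(closure ({π.base ζ'} : Set X))) + e := by
  have hM := coheight_closure_le_add_ringKrullDim_fibre π h
  have key := hπ.ringKrullDim_stalk_quotient_map_maximalIdeal_add_le x' hperm hs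
  set F := ringKrullDim (X'.presheaf.stalk x' ⧸ (maximalIdeal (X.presheaf.stalk (π.base x'))).map (π.stalkMap x').hom)
    with hF
  -- `F ≤ e`
  have hFe : F ≤ (e : WithBot ℕ∞) := by
    have h1 : F + ((s + 1 : ℕ) : WithBot ℕ∞) ≤ (e : WithBot ℕ∞) + ((s + 1 : ℕ) : WithBot ℕ∞) := by
      calc F + ((s + 1 : ℕ) : WithBot ℕ∞) ≤ ringKrullDim (X.presheaf.stalk (π.base x')) := key
        _ ≤ ((s + 1 + e : ℕ) : WithBot ℕ∞) := hdim
        _ = (e : WithBot ℕ∞) + ((s + 1 : ℕ) : WithBot ℕ∞) := by push_cast; ring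
    haveI : Nontrivial (X'.presheaf.stalk x' ⧸ (maximalIdeal (X.presheaf.stalk (π.base x'))).map (π.stalkMap x').hom) := by
      refine Ideal.Quotient.nontrivial_iff.mpr (ne_top_of_le_ne_top (Ideal.IsPrime.ne_top
        (inferInstance : (maximalIdeal (X'.presheaf.stalk x')).IsPrime)) ?_)
      rw [Ideal.map_le_iff_le_comap]
      exact fun r hr => map_nonunit (π.stalkMap x').hom r hr
    obtain ⟨c, hc⟩ : ∃ c : ℕ∞, F = c := by
      obtain ⟨c, hc⟩ := WithBot.ne_bot_iff_exists.mp
        (ne_bot_of_le_ne_bot WithBot.coe_ne_bot (ringKrullDim_nonneg_of_nontrivial (R := X'.presheaf.stalk x' ⧸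
          (maximalIdeal (X.presheaf.stalk (π.base x'))).map (π.stalkMap x').hom)))
      exact ⟨c, hc.symm⟩
    rw [hc] at h1 ⊢
    have h2 : c + ((s + 1 : ℕ) : ℕ∞) ≤ (e : ℕ∞) + ((s + 1 : ℕ) : ℕ∞) := by exact_mod_cast h1
    exact_mod_cast (ENat.add_le_add_iff_right (ENat.coe_ne_top _)).mp h2
  have h3 := hM.trans (add_le_add le_rfl hFe)
  have h4 : (((coheight (⟨x', specializes_iff_mem_closure.mp h⟩ : ↥(closure ({ζ'} : Set X'))) : ℕ∞)) : WithBot ℕ∞) ≤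
      (((coheight (⟨π.base x', specializes_iff_mem_closure.mp (h.map π.continuous)⟩ :
        ↥(closure ({π.base ζ'} : Set X))) + (e : ℕ∞) : ℕ∞)) : WithBot ℕ∞) := by
    push_cast; exact h3
  exact WithBot.coe_le_coe.mp h4

end Blowup

end Literature.AlgebraicGeometry.Resolution

end
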